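import Literature.MathematicalPhysics.QuantumFieldTheory.QCDPhaseQuenched
import HarnessLib

/-!
# Flavour-permutation covariance of the `N_f`-flavour Wilson–Dirac matrix and of the
# phase-quenched propagator moments

Topic `Literature/MathematicalPhysics/QuantumFieldTheory`; namespace
`Literature.MathematicalPhysics.QuantumFieldTheory`.

The tree's `N_f`-flavour Wilson matrix `diracMatrix U mq = ⊕_f D_W(U, m_f, 1)` (`QCDOS.lean`) is
flavour-diagonal with the bare mass `m_f` on the `f`-th block, so RELABELLING THE FLAVOURS TOGETHER
WITH THEIR MASSES is an exact symmetry: for every permutation `σ` of `Fin N_f`, the matrix at the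
permuted masses `mq ∘ σ` is the original matrix conjugated by the permutation
`(f, x, a, α) ↦ (σ f, x, a, α)` of the quark variables (`diracMatrix_comp_perm`; the relabelling is
written as the explicit equivalence `quarkEquiv⁻¹ ≫ (σ × id) ≫ quarkEquiv`, no new definition).
Consequences (all proved, configuration-wise, with NO invertibility hypothesis):

* `det_diracMatrix_comp_perm` — `det D(U, mq ∘ σ) = det D(U, mq)`: the fermion determinant, hence
  the phase-quenched weight `|det D|` and the sign `det D/|det D|`, is a symmetric function of the
  bare masses (Montvay–Münster §5.1.2: `det Q = ∏_f det Q_f`);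
* `inv_diracMatrix_comp_perm_apply` — the propagator blocks permute:
  `D(U, mq ∘ σ)⁻¹((f,p),(g,q)) = D(U, mq)⁻¹((σ f, p),(σ g, q))` (Mathlib's
  `Matrix.inv_submatrix_equiv`, valid also at singular `U`, where both sides are the junk inverse);
* `phaseQuenched_propagatorMoment_comp_perm` — the phase-quenched moment
  `E_{|w|,β,S}[(Σ_{a,i,b,j} |G_f((0,a,i),(v,b,j))|)^s]`, written as the LITERAL quotient of the QCD
  route statements (`WilsonMobilityGap.MobilityGap` (ii)–(iii), `PauliWegnerSea.OneScaleTrajectory`,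
  `PauliWegnerSea.FMClosureUnquenched`, …), satisfies `FM(mq ∘ σ, f) = FM(mq, σ f)`; in particular
  (`phaseQuenched_propagatorMoment_swap`) the moment of flavour `g` at the masses with `m_f, m_g`
  exchanged is the moment of flavour `f` at `mq` — so a bound on ONE flavour over a
  permutation-invariant set of mass tuples is a bound on EVERY flavour.

Source: I. Montvay, G. Münster, *Quantum Fields on a Lattice* (CUP 1994), §5.1.1–§5.1.2 (the
Wilson action of `N_f` flavours is the sum over `f` of one-flavour actions with masses `m_f`;
(5.6): at equal masses the full `U(N_f)` flavour symmetry). At unequal masses only "permute the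
flavours together with their masses" survives; it is recorded here because the route statements
quantify flavour by flavour (origin: stub `stub_noJump` of line `threshold-tuned-witness`, crux
stmt-QuantumFields-11513, whose flavour-transfer step (ii) it discharges).

Not here: the abelian flavour torus (`QCDFlavourSymmetry.lean`), Grassmann-level covariance of
`fermiBoltzmann` / `qcdTorusExpect` under flavour permutations.
-/

noncomputable section

open MeasureTheory
open Literature.MathematicalPhysics.QuantumLattice Literature.Probability.LatticeModels

namespace Literature.MathematicalPhysics.QuantumFieldTheory

variable {Nf : ℕ} {S : ℕ} [NeZero S]

/-- The flavour relabelling `(f, p) ↦ (σ f, p)` of the quark variables, transported to the tree's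
linear enumeration `FermiIdx` through `quarkEquiv`, sends the index of `(f, p)` to the index of
`(σ f, p)`. [folklore] -/
theorem flavourPerm_quarkEquiv (σ : Equiv.Perm (Fin Nf)) (v : QuarkVar Nf S) :
    ((quarkEquiv.symm.trans (Equiv.prodCongr σ (Equiv.refl _))).trans quarkEquiv)
        (quarkEquiv v) = quarkEquiv (σ v.1, v.2) := by
  simp [Prod.map]

/-- **Flavour-permutation covariance of the Wilson–Dirac matrix**: at the permuted bare masses
`mq ∘ σ` the `N_f`-flavour matrix is the original one conjugated by the relabelling
`P_σ : (f, p) ↦ (σ f, p)` of the quark indices (written as the explicit equivalence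
`quarkEquiv⁻¹ ≫ (σ × id) ≫ quarkEquiv`): `D(U, mq ∘ σ) = D(U, mq).submatrix P_σ P_σ`.
[cite: MontvayMunster1994, §5.1 (flavour-diagonal Wilson action)] -/
theorem diracMatrix_comp_perm (U : GaugeConfig 4 S SU3) (mq : Fin Nf → ℝ)
    (σ : Equiv.Perm (Fin Nf)) :
    diracMatrix U (mq ∘ σ) =
      (diracMatrix U mq).submatrix
        ((quarkEquiv.symm.trans (Equiv.prodCongr σ (Equiv.refl _))).trans quarkEquiv)
        ((quarkEquiv.symm.trans (Equiv.prodCongr σ (Equiv.refl _))).trans quarkEquiv) := by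
  ext i j
  obtain ⟨v, rfl⟩ := quarkEquiv.surjective i
  obtain ⟨w, rfl⟩ := quarkEquiv.surjective j
  simp only [diracMatrix, Matrix.reindex_apply, Matrix.submatrix_apply, Equiv.symm_apply_apply,
    flavourPerm_quarkEquiv, Matrix.of_apply, Function.comp_apply, σ.injective.eq_iff]

/-- **The `N_f`-flavour Wilson determinant is a symmetric function of the bare masses**:
`det D(U, mq ∘ σ) = det D(U, mq)` for every flavour permutation `σ` (so are the phase-quenched
weight `|det D|` and the reweighting sign). [cite: MontvayMunster1994, §5.1.2 (det Q = ∏_f det Q_f)] -/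
theorem det_diracMatrix_comp_perm (U : GaugeConfig 4 S SU3) (mq : Fin Nf → ℝ)
    (σ : Equiv.Perm (Fin Nf)) :
    (diracMatrix U (mq ∘ σ)).det = (diracMatrix U mq).det := by
  rw [diracMatrix_comp_perm, Matrix.det_submatrix_equiv_self]

/-- **The propagator blocks permute with the masses**:
`D(U, mq ∘ σ)⁻¹((f,p),(g,q)) = D(U, mq)⁻¹((σ f,p),(σ g,q))` — configuration-wise, with no
invertibility hypothesis (at singular `U` both sides are Mathlib's junk inverse, which is also
covariant: `Matrix.inv_submatrix_equiv`). [folklore] -/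
theorem inv_diracMatrix_comp_perm_apply (U : GaugeConfig 4 S SU3) (mq : Fin Nf → ℝ)
    (σ : Equiv.Perm (Fin Nf)) (f g : Fin Nf) (p q : TorusSite 4 S × Fin 3 × Fin 4) :
    (diracMatrix U (mq ∘ σ))⁻¹ (quarkEquiv (f, p)) (quarkEquiv (g, q)) =
      (diracMatrix U mq)⁻¹ (quarkEquiv (σ f, p)) (quarkEquiv (σ g, q)) := by
  rw [diracMatrix_comp_perm, Matrix.inv_submatrix_equiv, Matrix.submatrix_apply,
    flavourPerm_quarkEquiv, flavourPerm_quarkEquiv]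

/-- **Flavour-permutation covariance of the phase-quenched propagator moment** — the literal
quotient `E_{|w|,β,S}[(Σ_{a,i,b,j} |G_f((0,a,i),(v,b,j))|)^s]` of the QCD route statements on the
torus of side `2S+1`: the moment of flavour `f` at the permuted masses `mq ∘ σ` is the moment of
flavour `σ f` at `mq` (weight `|det|` symmetric, propagator blocks permuted). [folklore] -/
theorem phaseQuenched_propagatorMoment_comp_perm (β : ℝ) (S : ℕ) (mq : Fin Nf → ℝ)
    (σ : Equiv.Perm (Fin Nf)) (f : Fin Nf) (v : _root_.Literature.Probability.LatticeModels.Site 4)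
    (s : ℝ) :
    (∫ U : GaugeConfig 4 (2 * S + 1) SU3, ‖(diracMatrix U (mq ∘ σ)).det‖ *
          (∑ a : Fin 3, ∑ i : Fin 4, ∑ b : Fin 3, ∑ j : Fin 4,
            ‖(diracMatrix U (mq ∘ σ))⁻¹ (quarkEquiv (f, (Torus.proj (2 * S + 1) 0, a, i)))
              (quarkEquiv (f, (Torus.proj (2 * S + 1) v, b, j)))‖) ^ s
          ∂(wilsonMeasure (fundamentalRep (Fin 3)) β)) /
        (∫ U : GaugeConfig 4 (2 * S + 1) SU3, ‖(diracMatrix U (mq ∘ σ)).det‖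
          ∂(wilsonMeasure (fundamentalRep (Fin 3)) β)) =
      (∫ U : GaugeConfig 4 (2 * S + 1) SU3, ‖(diracMatrix U mq).det‖ *
          (∑ a : Fin 3, ∑ i : Fin 4, ∑ b : Fin 3, ∑ j : Fin 4,
            ‖(diracMatrix U mq)⁻¹ (quarkEquiv (σ f, (Torus.proj (2 * S + 1) 0, a, i)))
              (quarkEquiv (σ f, (Torus.proj (2 * S + 1) v, b, j)))‖) ^ s
          ∂(wilsonMeasure (fundamentalRep (Fin 3)) β)) /
        (∫ U : GaugeConfig 4 (2 * S + 1) SU3, ‖(diracMatrix U mq).det‖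
          ∂(wilsonMeasure (fundamentalRep (Fin 3)) β)) := by
  simp only [det_diracMatrix_comp_perm, inv_diracMatrix_comp_perm_apply]

/-- **Exchange of two flavours**: the phase-quenched moment of flavour `g` at the mass tuple with
`m_f` and `m_g` exchanged (`mq ∘ swap f g`) equals the moment of flavour `f` at `mq` — a bound for
ONE flavour over an exchange-invariant set of mass tuples is a bound for every flavour. [folklore] -/
theorem phaseQuenched_propagatorMoment_swap (β : ℝ) (S : ℕ) (mq : Fin Nf → ℝ) (f g : Fin Nf)
    (v : _root_.Literature.Probability.LatticeModels.Site 4) (s : ℝ) :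
    (∫ U : GaugeConfig 4 (2 * S + 1) SU3, ‖(diracMatrix U (mq ∘ Equiv.swap f g)).det‖ *
          (∑ a : Fin 3, ∑ i : Fin 4, ∑ b : Fin 3, ∑ j : Fin 4,
            ‖(diracMatrix U (mq ∘ Equiv.swap f g))⁻¹ (quarkEquiv (g, (Torus.proj (2 * S + 1) 0, a, i)))
              (quarkEquiv (g, (Torus.proj (2 * S + 1) v, b, j)))‖) ^ s
          ∂(wilsonMeasure (fundamentalRep (Fin 3)) β)) /
        (∫ U : GaugeConfig 4 (2 * S + 1) SU3, ‖(diracMatrix U (mq ∘ Equiv.swap f g)).det‖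
          ∂(wilsonMeasure (fundamentalRep (Fin 3)) β)) =
      (∫ U : GaugeConfig 4 (2 * S + 1) SU3, ‖(diracMatrix U mq).det‖ *
          (∑ a : Fin 3, ∑ i : Fin 4, ∑ b : Fin 3, ∑ j : Fin 4,
            ‖(diracMatrix U mq)⁻¹ (quarkEquiv (f, (Torus.proj (2 * S + 1) 0, a, i)))
              (quarkEquiv (f, (Torus.proj (2 * S + 1) v, b, j)))‖) ^ s
          ∂(wilsonMeasure (fundamentalRep (Fin 3)) β)) /
        (∫ U : GaugeConfig 4 (2 * S + 1) SU3, ‖(diracMatrix U mq).det‖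
          ∂(wilsonMeasure (fundamentalRep (Fin 3)) β)) := by
  rw [phaseQuenched_propagatorMoment_comp_perm, Equiv.swap_apply_right]

end Literature.MathematicalPhysics.QuantumFieldTheory

end
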